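import Literature.Topology.FourManifolds.KirbyMovesSurgery
import Literature.Topology.FourManifolds.KnotsProofs
import HarnessLib

/-!
# Reversing a component of a framed link does not change the surgery

Sibling proof file of `KirbyMovesSurgery.lean` (D-0014: named facts `def X : Prop` are
discharged as `theorem X_holds : X`), proving leaf (V) of the decomposition of Kirby's theorem
("if" direction, `Literature.Topology.FourManifolds.KirbyEquivalent.nonempty_diffeomorph`) recorded there:

* `Literature.Topology.FourManifolds.FramedLink.IsSurgery.reverseComponent'` — if the manifold `Y` (any model `IY`) is surgery
  on the framed link `L` (`L.IsSurgery IY Y`, the relational integral Dehn surgery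
  `Literature.Topology.FourManifolds.IsIntegralSurgeryLink` of `DehnSurgery.lean`), then `Y` is surgery on
  `L.reverseComponent i` (`KirbyMoves.lean`: the same framed link with the orientation of the
  `i`-th component reversed and the same framing integers), for every finite index type, framed
  link and component;
* `Literature.FramedLink.IsSurgery.reverseComponent_holds : FramedLink.IsSurgery.reverseComponent` —
  the discharge of the named fact (leaf (V)) of `KirbyMovesSurgery.lean`.

## Source

Framed links are unoriented: Kirby, *The Topology of 4-Manifolds*, LNM 1374 (1989), Ch. I §2
(p. 6 of the PDF) attaches a 2-handle along `f (S¹ × B²)` and records the framing as the integer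
by which `f (S¹ × e₁)` twists around `f (S¹ × 0)`, i.e. the linking number of the push-off with the
attaching circle — a quantity blind to the orientation of the circle (reversing the circle
reverses both curves). Likewise Rolfsen, *Knots and Links* (1976), §9.F and Gompf–Stipsicz (1999),
§5.1. No source spells out a proof; the argument below is the evident transport of the surgery
presentation.

## Proof

Let `(ν, jA, jB)` present `Y` as surgery on `L` (`IsIntegralSurgeryLink`: oriented tubular
neighbourhoods `νₖ` with framings `nₖ`, an open embedding `jA` of the link complement and open
embeddings `jBₖ` of solid tori, glued along `Link.surgeryRel ν k`).

* `Literature.Topology.FourManifolds.Knot.TubularNbhd.reverse`: precomposing `νᵢ : 𝕊 1 × ℝ² → 𝕊 3` with the involution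
  `(x, (w₀, w₁)) ↦ (x̄, (w₀, -w₁))` (`circlePlaneFlip`; `x̄ = reflectLast 1 x`) gives an oriented
  tubular neighbourhood of the reversed knot `Kᵢ ∘ reflectLast 1 = ⇑Kᵢ.reverse`: a smooth
  embedding (the tree's `Manifold.IsSmoothEmbedding.comp_diffeomorph`), extending the reversed
  knot, and still positively oriented — in the frame `(ν, ∂_θ ν, ∂_{w₀} ν, ∂_{w₁} ν)` of `det_pos`
  exactly the second and the fourth rows change sign (`reflectLast 1 (circlePoint θ) =
  circlePoint (-θ)` and the chain rule `deriv (f ∘ neg)`), which leaves the determinant unchanged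
  (`det_of_neg_neg`).
* `Literature.Topology.FourManifolds.Knot.TubularNbhd.HasFraming.reverseKnot`: the reversed neighbourhood has the same framing
  integer. Its meridian `θ ↦ ν (x̄₀, ½ (cos, -sin)(2πθ))` and its longitude
  `θ ↦ ν ((cos, -sin)(2πθ), e₀)` are the *reversed* meridian and longitude of `ν`
  (`meridian_reverseKnot`, `longitude_reverseKnot`; as loops in the common complement
  `S³ ∖ K = S³ ∖ K.reverse`, identified by `toReverseCompl`), so under the induced homomorphism of
  abelianised fundamental groups (`FundamentalGroup.mapOfEq`, `Abelianization.map`) the relation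
  `[λ] = m • [μ]` of `ν` becomes `-[λ'] = m • (-[μ'])`, i.e. `[λ'] = m • [μ']`.
* `Literature.Topology.FourManifolds.Knot.TubularNbhd.glueRel_reverse_iff`: the surgery relation of the reversed neighbourhood
  is that of `ν` after the flip `(p, v) ↦ (p̄, v̄)` of `ℝ² × 𝕊 1`, which restricts to a
  self-diffeomorphism `solidTorusFlip` of the open solid torus; hence `jBᵢ ∘ solidTorusFlip`
  (again an open smooth embedding with the same image) is glued to the unchanged `jA` exactly along
  the surgery relation of the reversed neighbourhood.
* `Literature.Topology.FourManifolds.FramedLink.IsSurgery.reverseNone` assembles this for the component `none` of a link indexed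
  by `Option κ` (written with definitional case analysis, `FramedLink.reverseNone`, equal to
  `reverseComponent none`), and `IsSurgery.reverseComponent'` reduces the general case to it by
  renumbering along `Equiv.optionSubtypeNe i` (surgery is invariant under renumbering: the tree's
  proved `FramedLink.IsSurgery.reindex`, `isSurgery_reindex_iff_holds`).

## References

* R. C. Kirby, *The Topology of 4-Manifolds*, Lecture Notes in Math. 1374, Springer (1989),
  Ch. I §2. [cite: Kirby1989, Ch. I §2]
* D. Rolfsen, *Knots and Links* (1976), §9.F. [cite: Rolfsen1976, §9.F]
-/

open scoped Manifold ContDiff Topology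
open Function Set

noncomputable section

universe u v w u'

namespace Literature.Topology.FourManifolds

/-- Local notation: `𝔼 n` is the model Euclidean space `EuclideanSpace ℝ (Fin n)`. -/
local notation "𝔼 " n:arg => EuclideanSpace ℝ (Fin n)

/-- Local notation: `𝕊 n` is the unit sphere in `EuclideanSpace ℝ (Fin (n + 1))`. -/
local notation "𝕊 " n:arg => (Metric.sphere (0 : EuclideanSpace ℝ (Fin (n + 1))) 1)

/-! ## The reflection `(w₀, w₁) ↦ (w₀, -w₁)` of the plane -/

/-- The reflection `(w₀, w₁) ↦ (w₀, -w₁)` of `ℝ²` in the first axis, as a continuous linear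
equivalence (it is the involution `reflectLastCLM 1`). [folklore] -/
def planeFlip : 𝔼 2 ≃L[ℝ] 𝔼 2 :=
  ContinuousLinearEquiv.equivOfInverse (reflectLastCLM 1) (reflectLastCLM 1)
    (fun w ↦ by ext i; fin_cases i <;> simp [reflectLastCLM])
    (fun w ↦ by ext i; fin_cases i <;> simp [reflectLastCLM])

/-- The plane reflection fixes the first coordinate. [folklore] -/
@[simp] theorem planeFlip_apply_zero (w : 𝔼 2) : planeFlip w 0 = w 0 := by
  simp [planeFlip, reflectLastCLM]

/-- The plane reflection negates the second coordinate. [folklore] -/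
@[simp] theorem planeFlip_apply_one (w : 𝔼 2) : planeFlip w 1 = -w 1 := by
  simp [planeFlip, reflectLastCLM]

/-- The plane reflection is an involution. [folklore] -/
@[simp] theorem planeFlip_planeFlip (w : 𝔼 2) : planeFlip (planeFlip w) = w := by
  ext i; fin_cases i <;> simp

/-- The plane reflection is an isometry. [folklore] -/
theorem norm_planeFlip (w : 𝔼 2) : ‖planeFlip w‖ = ‖w‖ := by
  simp only [EuclideanSpace.norm_eq, Fin.sum_univ_two, planeFlip_apply_zero, planeFlip_apply_one,
    norm_neg]

/-- On the unit circle the plane reflection is `reflectLast 1`. [folklore] -/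
theorem planeFlip_coe_sphere (u : 𝕊 1) : planeFlip (u : 𝔼 2) = (reflectLast 1 u : 𝔼 2) := by
  ext i; fin_cases i <;> simp [reflectLast]

/-- The plane reflection maps `circlePoint θ` to `circlePoint (-θ)`. [folklore] -/
theorem planeFlip_circlePoint (θ : ℝ) :
    planeFlip ((circlePoint θ : 𝕊 1) : 𝔼 2) = ((circlePoint (-θ) : 𝕊 1) : 𝔼 2) := by
  ext i; fin_cases i <;> simp [Real.cos_neg, Real.sin_neg]

/-- The reflection `reflectLast 1` of the circle maps `circlePoint θ` to `circlePoint (-θ)`. [folklore] -/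
theorem reflectLast_circlePoint (θ : ℝ) : reflectLast 1 (circlePoint θ) = circlePoint (-θ) := by
  apply Subtype.ext
  rw [← planeFlip_coe_sphere, planeFlip_circlePoint]

/-- The plane reflection fixes the first basis vector. [folklore] -/
theorem planeFlip_single_zero (s : ℝ) :
    planeFlip (EuclideanSpace.single 0 s) = EuclideanSpace.single 0 s := by
  ext i; fin_cases i <;> simp

/-- The plane reflection negates the second basis vector. [folklore] -/
theorem planeFlip_single_one (s : ℝ) :
    planeFlip (EuclideanSpace.single 1 s) = EuclideanSpace.single 1 (-s) := by
  ext i; fin_cases i <;> simp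

/-- The plane reflection fixes the base vector `e₀ = (½, 0)` of the framing curves. [folklore] -/
theorem planeFlip_framingBaseVector : planeFlip framingBaseVector = framingBaseVector := by
  ext i; fin_cases i <;> simp [framingBaseVector]

/-! ## The involution `(x, w) ↦ (x̄, w̄)` of `𝕊 1 × ℝ²` and the reversed tubular neighbourhood -/

/-- The involution `(x, w) ↦ (reflectLast 1 x, planeFlip w)` of `𝕊 1 × ℝ²` as a diffeomorphism
(product of the reflection diffeomorphism of the circle and the linear plane reflection). [folklore] -/
def circlePlaneFlip :
    ((𝕊 1) × (𝔼 2)) ≃ₘ⟮(𝓡 1).prod 𝓘(ℝ, 𝔼 2), (𝓡 1).prod 𝓘(ℝ, 𝔼 2)⟯ ((𝕊 1) × (𝔼 2)) :=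
  (reflectLastDiffeo 1).prodCongr planeFlip.toDiffeomorph

/-- The involution of `𝕊 1 × ℝ²` on points. [folklore] -/
@[simp] theorem circlePlaneFlip_apply (p : (𝕊 1) × (𝔼 2)) :
    circlePlaneFlip p = (reflectLast 1 p.1, planeFlip p.2) := rfl

namespace Knot.TubularNbhd

variable {K : 𝕊 1 → 𝕊 3} (ν : Knot.TubularNbhd K)

/-- Negating rows `1` and `3` of a `4 × 4` matrix does not change the determinant. [folklore] -/
theorem det_of_neg_neg (a b c d : Fin 4 → ℝ) :
    Matrix.det (Matrix.of ![a, -b, c, -d]) = Matrix.det (Matrix.of ![a, b, c, d]) := by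
  have h : Matrix.of ![a, -b, c, -d] = Matrix.diagonal ![1, -1, 1, -1] * Matrix.of ![a, b, c, d] := by
    ext i j
    rw [Matrix.diagonal_mul]
    fin_cases i <;> simp
  rw [h, Matrix.det_mul, Matrix.det_diagonal]
  simp [Fin.prod_univ_four]

/-- **The reversed tubular neighbourhood.** Precomposing an oriented tubular neighbourhood `ν` of
`K` with the involution `(x, (w₀, w₁)) ↦ (x̄, (w₀, -w₁))` gives an oriented tubular neighbourhood
of the reversed knot `K ∘ reflectLast 1`: it is again a smooth embedding extending the (reversed)
knot, and the frame `(ν, ∂_θ, ∂_{w₀}, ∂_{w₁})` picks up exactly two signs (in `∂_θ` and in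
`∂_{w₁}`), so `det_pos` is preserved. Its meridian and its longitude are the reversed meridian and
longitude of `ν`, whence the same framing integer (`HasFraming.reverse`). Kirby (1989), Ch. I §2
(framed links are unoriented). [cite: Kirby1989, Ch. I §2] -/
def reverse : Knot.TubularNbhd (K ∘ reflectLast 1) where
  toFun p := ν (reflectLast 1 p.1, planeFlip p.2)
  isSmoothEmbedding := by
    have : (fun p : (𝕊 1) × (𝔼 2) ↦ ν (reflectLast 1 p.1, planeFlip p.2)) = ⇑ν ∘ circlePlaneFlip := by
      funext p; rfl
    rw [this]
    exact ν.isSmoothEmbedding_coe.comp_diffeomorph circlePlaneFlip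
  apply_zero x := by
    change ν (reflectLast 1 x, planeFlip 0) = K (reflectLast 1 x)
    rw [map_zero, ν.coe_apply_zero]
  det_pos θ w := by
    -- the four rows of the frame of `ν.reverse` at `(θ, w)` are the rows of the frame of `ν` at
    -- the reflected point `(-θ, w̄)`, the second and the fourth negated
    set F₁ : ℝ → 𝔼 4 := fun t ↦ ((ν (circlePoint t, planeFlip w) : 𝕊 3) : 𝔼 4) with hF₁
    set F₃ : ℝ → 𝔼 4 := fun s ↦
      ((ν (circlePoint (-θ), planeFlip w + EuclideanSpace.single 1 s) : 𝕊 3) : 𝔼 4) with hF₃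
    have h0 : ν (reflectLast 1 (circlePoint θ), planeFlip w) = ν (circlePoint (-θ), planeFlip w) := by
      rw [reflectLast_circlePoint]
    have h1 : (fun t : ℝ ↦ ((ν (reflectLast 1 (circlePoint t), planeFlip w) : 𝕊 3) : 𝔼 4)) =
        fun t ↦ F₁ (-t) := by
      funext t; rw [hF₁, reflectLast_circlePoint]
    have h2 : (fun s : ℝ ↦ ((ν (reflectLast 1 (circlePoint θ),
        planeFlip (w + EuclideanSpace.single 0 s)) : 𝕊 3) : 𝔼 4)) =
        fun s ↦ ((ν (circlePoint (-θ), planeFlip w + EuclideanSpace.single 0 s) : 𝕊 3) : 𝔼 4) := by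
      funext s; rw [map_add, planeFlip_single_zero, reflectLast_circlePoint]
    have h3 : (fun s : ℝ ↦ ((ν (reflectLast 1 (circlePoint θ),
        planeFlip (w + EuclideanSpace.single 1 s)) : 𝕊 3) : 𝔼 4)) = fun s ↦ F₃ (-s) := by
      funext s; rw [hF₃, map_add, planeFlip_single_one, reflectLast_circlePoint]
    change 0 < Matrix.det (Matrix.of
      ![⇑((ν (reflectLast 1 (circlePoint θ), planeFlip w) : 𝕊 3) : 𝔼 4),
        ⇑(deriv (fun t : ℝ ↦ ((ν (reflectLast 1 (circlePoint t), planeFlip w) : 𝕊 3) : 𝔼 4)) θ),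
        ⇑(deriv (fun s : ℝ ↦ ((ν (reflectLast 1 (circlePoint θ),
          planeFlip (w + EuclideanSpace.single 0 s)) : 𝕊 3) : 𝔼 4)) 0),
        ⇑(deriv (fun s : ℝ ↦ ((ν (reflectLast 1 (circlePoint θ),
          planeFlip (w + EuclideanSpace.single 1 s)) : 𝕊 3) : 𝔼 4)) 0)])
    rw [h1, h2, h3, deriv_comp_neg, deriv_comp_neg, neg_zero, h0]
    rw [show ∀ (a b c d : 𝔼 4), Matrix.of ![⇑a, ⇑(-b), ⇑c, ⇑(-d)] = Matrix.of ![⇑a, -⇑b, ⇑c, -⇑d]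
      from fun a b c d ↦ rfl, det_of_neg_neg]
    exact ν.det_pos (-θ) (planeFlip w)

/-- The reversed tubular neighbourhood as a function. [folklore] -/
@[simp] theorem reverse_apply (p : (𝕊 1) × (𝔼 2)) :
    ν.reverse p = ν (reflectLast 1 p.1, planeFlip p.2) := rfl

/-- The reversed tubular neighbourhood has the same image. [folklore] -/
theorem range_reverse : range ⇑ν.reverse = range ⇑ν := by
  have : ⇑ν.reverse = ⇑ν ∘ circlePlaneFlip := by funext p; rfl
  rw [this, (EquivLike.surjective circlePlaneFlip).range_comp]

end Knot.TubularNbhd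

/-! ## The framing of the reversed tubular neighbourhood -/

namespace SphereEmbedding

variable {k n : ℕ}

/-- The identity map between the complements of two sphere embeddings with the same image, as a
continuous map. [folklore] -/
def complementCast {K K' : SphereEmbedding k n} (h : range ⇑K = range ⇑K') :
    C(K.complement, K'.complement) where
  toFun x := ⟨x.1, by rw [mem_complement_iff, ← h]; exact x.2⟩
  continuous_toFun := by fun_prop

/-- The identity map between complements, on points. [folklore] -/
@[simp] theorem coe_complementCast_apply {K K' : SphereEmbedding k n} (h : range ⇑K = range ⇑K')
    (x : K.complement) : (complementCast h x : 𝕊 n) = x := rfl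

end SphereEmbedding

namespace Knot.TubularNbhd

variable {K : Knot} (ν : Knot.TubularNbhd K)

/-- The reversed tubular neighbourhood of a knot `K`, as a tubular neighbourhood of the reversed
knot `K.reverse` (`⇑K.reverse = ⇑K ∘ reflectLast 1` definitionally). [folklore] -/
abbrev reverseKnot : Knot.TubularNbhd (K.reverse : Knot) := ν.reverse

/-- The identity map `S³ ∖ K → S³ ∖ K.reverse` (the two knots have the same image). [folklore] -/
def toReverseCompl (K : Knot) : C(K.complement, (K.reverse : Knot).complement) :=
  SphereEmbedding.complementCast (Knot.range_reverse K).symm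

/-- `circlePoint (2π (1 - t)) = circlePoint (-(2π t))`. [folklore] -/
theorem circlePoint_two_pi_mul_one_sub (t : ℝ) :
    circlePoint (2 * Real.pi * (1 - t)) = circlePoint (-(2 * Real.pi * t)) := by
  rw [show 2 * Real.pi * (1 - t) = -(2 * Real.pi * t) + 2 * Real.pi by ring, circlePoint_add_two_pi]

/-- The base point of the reversed tubular neighbourhood is the base point of `ν` (as points of
the common complement). [folklore] -/
theorem toReverseCompl_basePoint : toReverseCompl K ν.basePoint = ν.reverseKnot.basePoint := by
  apply Subtype.ext
  change ν (circlePoint 0, framingBaseVector) = ν (reflectLast 1 (circlePoint 0), planeFlip framingBaseVector)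
  rw [reflectLast_circlePoint, neg_zero, planeFlip_framingBaseVector]

/-- **The meridian of the reversed tubular neighbourhood is the reversed meridian** (transported
to the complement of the reversed knot and based at the transported base point). [folklore] -/
theorem meridian_reverseKnot : ν.reverseKnot.meridian =
    (((ν.meridian.map (toReverseCompl K).continuous).cast ν.toReverseCompl_basePoint.symm
      ν.toReverseCompl_basePoint.symm).symm) := by
  apply Path.ext
  funext t
  apply Subtype.ext
  change ν (reflectLast 1 (circlePoint 0),
      planeFlip ((1 / 2 : ℝ) • ((circlePoint (2 * Real.pi * t) : 𝕊 1) : 𝔼 2))) =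
    ν (circlePoint 0, (1 / 2 : ℝ) • ((circlePoint (2 * Real.pi * (unitInterval.symm t : ℝ)) : 𝕊 1) : 𝔼 2))
  rw [reflectLast_circlePoint, neg_zero, map_smul, planeFlip_circlePoint, unitInterval.coe_symm_eq,
    circlePoint_two_pi_mul_one_sub]

/-- **The longitude of the reversed tubular neighbourhood is the reversed longitude.** [folklore] -/
theorem longitude_reverseKnot : ν.reverseKnot.longitude =
    (((ν.longitude.map (toReverseCompl K).continuous).cast ν.toReverseCompl_basePoint.symm
      ν.toReverseCompl_basePoint.symm).symm) := by
  apply Path.ext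
  funext t
  apply Subtype.ext
  change ν (reflectLast 1 (circlePoint (2 * Real.pi * t)), planeFlip framingBaseVector) =
    ν (circlePoint (2 * Real.pi * (unitInterval.symm t : ℝ)), framingBaseVector)
  rw [reflectLast_circlePoint, planeFlip_framingBaseVector, unitInterval.coe_symm_eq,
    circlePoint_two_pi_mul_one_sub]

/-- In the fundamental group of the complement of the reversed knot, the class of a reversed,
transported loop is the inverse of the transported class. [folklore] -/
theorem fromPath_mk_symm_cast_map {b' : (K.reverse : Knot).complement}
    (γ : Path ν.basePoint ν.basePoint) (hb : toReverseCompl K ν.basePoint = b') :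
    FundamentalGroup.fromPath (Path.Homotopic.Quotient.mk
      (((γ.map (toReverseCompl K).continuous).cast hb.symm hb.symm).symm)) =
      (FundamentalGroup.mapOfEq (toReverseCompl K) hb
        (FundamentalGroup.fromPath (Path.Homotopic.Quotient.mk γ)))⁻¹ := by
  rw [FundamentalGroup.mapOfEq_apply, FundamentalGroup.inv_def, Path.Homotopic.Quotient.mk_symm,
    Path.Homotopic.Quotient.mk_cast, Path.Homotopic.Quotient.mk_map]

/-- **Reversing preserves the framing**: if `ν` has framing `m` then the reversed tubular
neighbourhood `ν.reverseKnot` of `K.reverse` has framing `m`. Both the meridian and the longitude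
are reversed (`meridian_reverseKnot`, `longitude_reverseKnot`), so in
`π₁(S³ ∖ K.reverse)ᵃᵇ = π₁(S³ ∖ K)ᵃᵇ` the relation `[λ] = m • [μ]` becomes `-[λ] = m • (-[μ])`.
Kirby (1989), Ch. I §2 (the framing integer does not depend on the orientation of the attaching
circle). [cite: Kirby1989, Ch. I §2] -/
theorem HasFraming.reverseKnot {m : ℤ} (h : ν.HasFraming m) : ν.reverseKnot.HasFraming m := by
  unfold HasFraming at h ⊢
  set G := FundamentalGroup.mapOfEq (toReverseCompl K) ν.toReverseCompl_basePoint with hG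
  have h' := congrArg (Abelianization.map G) h
  simp only [map_zpow, Abelianization.map_of] at h'
  rw [ν.meridian_reverseKnot, ν.longitude_reverseKnot,
    ν.fromPath_mk_symm_cast_map _ ν.toReverseCompl_basePoint,
    ν.fromPath_mk_symm_cast_map _ ν.toReverseCompl_basePoint, map_inv, map_inv, ← hG, h', inv_zpow]

end Knot.TubularNbhd

/-! ## The flip of the solid torus and the surgery relation -/

/-- The involution `(p, v) ↦ (p̄, v̄) = (planeFlip p, reflectLast 1 v)` of `ℝ² × 𝕊 1` as a
diffeomorphism. [folklore] -/
def planeCircleFlip :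
    ((𝔼 2) × (𝕊 1)) ≃ₘ⟮𝓘(ℝ, 𝔼 2).prod (𝓡 1), 𝓘(ℝ, 𝔼 2).prod (𝓡 1)⟯ ((𝔼 2) × (𝕊 1)) :=
  planeFlip.toDiffeomorph.prodCongr (reflectLastDiffeo 1)

/-- The involution of `ℝ² × 𝕊 1` on points. [folklore] -/
@[simp] theorem planeCircleFlip_apply (b : (𝔼 2) × (𝕊 1)) :
    planeCircleFlip b = (planeFlip b.1, reflectLast 1 b.2) := rfl

/-- The flip of `ℝ² × 𝕊 1` is an involution. [folklore] -/
theorem planeCircleFlip_planeCircleFlip (b : (𝔼 2) × (𝕊 1)) :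
    planeCircleFlip (planeCircleFlip b) = b := by
  simp

/-- The flip preserves the open solid torus `{‖p‖ < 1}`. [folklore] -/
theorem planeCircleFlip_mem_solidTorus {b : (𝔼 2) × (𝕊 1)} (hb : b ∈ solidTorus) :
    planeCircleFlip b ∈ solidTorus := by
  rw [mem_solidTorus_iff] at hb ⊢
  simpa [norm_planeFlip] using hb

/-- **The flip of the open solid torus** `(p, v) ↦ (p̄, v̄)`, a self-diffeomorphism of the open
submanifold `solidTorus ⊆ ℝ² × 𝕊 1` (restriction of `planeCircleFlip`). [folklore] -/
def solidTorusFlip :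
    solidTorus ≃ₘ⟮𝓘(ℝ, 𝔼 2).prod (𝓡 1), 𝓘(ℝ, 𝔼 2).prod (𝓡 1)⟯ solidTorus where
  toFun b := ⟨planeCircleFlip b, planeCircleFlip_mem_solidTorus b.2⟩
  invFun b := ⟨planeCircleFlip b, planeCircleFlip_mem_solidTorus b.2⟩
  left_inv _ := Subtype.ext (planeCircleFlip_planeCircleFlip _)
  right_inv _ := Subtype.ext (planeCircleFlip_planeCircleFlip _)
  contMDiff_toFun := (ContMDiff.subtypeVal_comp_iff solidTorus _).1
    (planeCircleFlip.contMDiff.comp contMDiff_subtype_val)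
  contMDiff_invFun := (ContMDiff.subtypeVal_comp_iff solidTorus _).1
    (planeCircleFlip.contMDiff.comp contMDiff_subtype_val)

/-- The flip of the solid torus on points. [folklore] -/
@[simp] theorem coe_solidTorusFlip (b : solidTorus) :
    (solidTorusFlip b : (𝔼 2) × (𝕊 1)) = planeCircleFlip b := rfl

/-- Precomposing with the flip of the solid torus does not change the image. [folklore] -/
theorem range_comp_solidTorusFlip {Y : Type*} (f : solidTorus → Y) :
    range (f ∘ solidTorusFlip) = range f :=
  (EquivLike.surjective solidTorusFlip).range_comp f

namespace Knot.TubularNbhd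

variable {K : 𝕊 1 → 𝕊 3} (ν : Knot.TubularNbhd K)

/-- **The surgery relation of the reversed tubular neighbourhood** is the surgery relation of `ν`
after flipping the solid torus: `(t • u, v) ∼' a ↔ (t • ū, v̄) ∼ a`. [folklore] -/
theorem glueRel_reverse_iff (a : 𝕊 3) (b : (𝔼 2) × (𝕊 1)) :
    ν.reverse.glueRel a b ↔ ν.glueRel a (planeCircleFlip b) := by
  constructor
  · rintro ⟨u, t, ht, hb, ha⟩
    refine ⟨reflectLast 1 u, t, ht, ?_, ?_⟩
    · rw [planeCircleFlip_apply, hb, map_smul, planeFlip_coe_sphere]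
    · rw [ha, reverse_apply, map_smul, planeFlip_coe_sphere, planeCircleFlip_apply]
  · rintro ⟨u, t, ht, hb, ha⟩
    refine ⟨reflectLast 1 u, t, ht, ?_, ?_⟩
    · have := congrArg planeFlip hb
      rwa [planeCircleFlip_apply, planeFlip_planeFlip, map_smul, planeFlip_coe_sphere] at this
    · rw [reverse_apply, reflectLast_reflectLast, map_smul, planeFlip_coe_sphere]
      exact ha

end Knot.TubularNbhd

/-! ## Reversing a component of a framed link does not change the surgery -/

namespace FramedLink

variable {κ : Type*}

/-- The framed link obtained from `L : FramedLink (Option κ)` by reversing the component `none`,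
written with `Option.elim` so that its components reduce definitionally
(`reverseNone_eq_reverseComponent`: it *is* `L.reverseComponent none`). [folklore] -/
def reverseNone (L : FramedLink (Option κ)) : FramedLink (Option κ) where
  component o := o.elim (L.component none).reverse fun k ↦ L.component (some k)
  disjoint := by
    have hr : ∀ o : Option κ, range ⇑(o.elim (L.component none).reverse fun k ↦ L.component (some k)) =
        range ⇑(L.component o) := by
      rintro (_ | k)
      · exact Knot.range_reverse _
      · rfl
    intro o o' h
    rw [hr, hr]
    exact L.disjoint h
  framing := L.framing

/-- The reversed component of `reverseNone`. [folklore] -/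
@[simp] theorem reverseNone_component_none (L : FramedLink (Option κ)) :
    L.reverseNone.component none = (L.component none).reverse := rfl

/-- The other components of `reverseNone` are unchanged. [folklore] -/
@[simp] theorem reverseNone_component_some (L : FramedLink (Option κ)) (k : κ) :
    L.reverseNone.component (some k) = L.component (some k) := rfl

/-- The framings of `reverseNone` are unchanged. [folklore] -/
@[simp] theorem reverseNone_framing (L : FramedLink (Option κ)) : L.reverseNone.framing = L.framing := rfl

/-- `reverseNone` is `reverseComponent none`. [folklore] -/
theorem reverseNone_eq_reverseComponent [DecidableEq κ] (L : FramedLink (Option κ)) :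
    L.reverseNone = L.reverseComponent none :=
  ext' (funext <| by rintro (_ | k) <;> simp) rfl

/-- Reversing a component does not change the link complement. [folklore] -/
theorem complement_reverseNone [Finite κ] (L : FramedLink (Option κ)) :
    L.reverseNone.toLink.complement = L.toLink.complement :=
  SetLike.ext fun x ↦ by
    simp only [Link.mem_complement_iff]
    refine ⟨fun h o ↦ ?_, fun h o ↦ ?_⟩
    · rcases o with _ | k
      · have := h none
        rwa [reverseNone_component_none, Knot.range_reverse] at this
      · exact h (some k)
    · rcases o with _ | k
      · rw [reverseNone_component_none, Knot.range_reverse]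
        exact h none
      · exact h (some k)

/-- **Reversing the component `none` does not change the surgery** (same manifold, same model):
transport the presentation — reverse the tubular neighbourhood of that component
(`Knot.TubularNbhd.reverseKnot`: still oriented, same framing by `HasFraming.reverseKnot`), keep
the embedding of the (unchanged) link complement, and precompose the embedding of that solid
torus with the flip `solidTorusFlip`, which matches the two surgery relations
(`glueRel_reverse_iff`). Kirby (1989), Ch. I §2. [cite: Kirby1989, Ch. I §2] -/
theorem IsSurgery.reverseNone {EY HY : Type*} [NormedAddCommGroup EY] [NormedSpace ℝ EY]
    [TopologicalSpace HY] {IY : ModelWithCorners ℝ EY HY} {Y : Type*} [TopologicalSpace Y]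
    [ChartedSpace HY Y] [Finite κ] {L : FramedLink (Option κ)} (h : L.IsSurgery IY Y) :
    L.reverseNone.IsSurgery IY Y := by
  obtain ⟨ν, hν, hdisj, jA, jB, hA, hAo, hB, hcov, hBdisj, hglue⟩ := h
  let ν' : ∀ o, Knot.TubularNbhd ⇑(L.reverseNone.component o) := fun o ↦
    match o with
    | none => (ν none).reverseKnot
    | some k => ν (some k)
  have hr : ∀ o, range ⇑(ν' o) = range ⇑(ν o) := by
    rintro (_ | k)
    · exact (ν none).range_reverse
    · rfl
  refine ⟨ν', ?_, fun o o' hoo' ↦ ?_, ?_⟩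
  · rintro (_ | k)
    · exact Knot.TubularNbhd.HasFraming.reverseKnot _ (hν none)
    · exact hν (some k)
  · change Disjoint (range ⇑(ν' o)) (range ⇑(ν' o'))
    rw [hr, hr]
    exact hdisj hoo'
  simp only [Link.surgeryRel]
  rw [complement_reverseNone L]
  refine ⟨jA, fun o ↦ o.elim (jB none ∘ solidTorusFlip) fun k ↦ jB (some k), hA, hAo, ?_, ?_,
    fun o o' hoo' ↦ ?_, ?_⟩
  · rintro (_ | k)
    · refine ⟨(hB none).1.comp_diffeomorph solidTorusFlip, ?_⟩
      change IsOpen (range (jB none ∘ solidTorusFlip))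
      rw [range_comp_solidTorusFlip]
      exact (hB none).2
    · exact hB (some k)
  · convert hcov using 2
    refine iUnion_congr ?_
    rintro (_ | k)
    · exact range_comp_solidTorusFlip _
    · rfl
  · have hr' : ∀ o : Option κ, range (o.elim (jB none ∘ solidTorusFlip) fun k ↦ jB (some k)) =
        range (jB o) := by
      rintro (_ | k)
      · exact range_comp_solidTorusFlip _
      · rfl
    change Disjoint (range (o.elim (jB none ∘ solidTorusFlip) fun k ↦ jB (some k)))
      (range (o'.elim (jB none ∘ solidTorusFlip) fun k ↦ jB (some k)))
    rw [hr', hr']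
    exact hBdisj hoo'
  · rintro (_ | k) a b
    · change jA a = jB none (solidTorusFlip b) ↔ (ν none).reverse.glueRel a b
      rw [hglue none a (solidTorusFlip b), (ν none).glueRel_reverse_iff]
      rfl
    · exact hglue (some k) a b

/-- **Reversing a component does not change the surgery** — discharge form of the leaf
`FramedLink.IsSurgery.reverseComponent` of `KirbyMovesSurgery.lean`, for one framed link: if `Y`
is surgery on `L` then `Y` is surgery on `L.reverseComponent i`. Renumber the components by
`Equiv.optionSubtypeNe i : Option {k // k ≠ i} ≃ ι` (surgery is invariant, the proved
`FramedLink.IsSurgery.reindex` / `isSurgery_reindex_iff_holds`), so that `i` becomes `none`, and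
apply `IsSurgery.reverseNone`. Kirby (1989), Ch. I §2 (framed links are unoriented).
[cite: Kirby1989, Ch. I §2] -/
theorem IsSurgery.reverseComponent' {EY HY : Type*} [NormedAddCommGroup EY] [NormedSpace ℝ EY]
    [TopologicalSpace HY] {IY : ModelWithCorners ℝ EY HY} {Y : Type*} [TopologicalSpace Y]
    [ChartedSpace HY Y] {ι : Type*} [Finite ι] [DecidableEq ι] {L : FramedLink ι}
    (h : L.IsSurgery IY Y) (i : ι) : (L.reverseComponent i).IsSurgery IY Y := by
  set e : Option {k // k ≠ i} ≃ ι := Equiv.optionSubtypeNe i with he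
  have h1 : (L.reindex e).reverseNone.IsSurgery IY Y := (h.reindex e).reverseNone
  have h2 : (L.reindex e).reverseNone = (L.reverseComponent i).reindex e := by
    refine ext' (funext ?_) (funext ?_)
    · rintro (_ | ⟨k, hk⟩)
      · simp [he]
      · simp [he, hk]
    · rintro (_ | ⟨k, hk⟩) <;> simp [he]
  rw [h2] at h1
  exact (isSurgery_reindex_iff_holds e _).1 h1

/-- Discharge of the named fact `FramedLink.IsSurgery.reverseComponent` (`KirbyMovesSurgery.lean`,
leaf (V) of the decomposition of `KirbyEquivalent.nonempty_diffeomorph`): **reversing a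
component of a framed link does not change the surgery**, for every model, manifold, finite
index type, framed link and component (`IsSurgery.reverseComponent'`). Kirby (1989), Ch. I §2
(framed links are unoriented). [cite: Kirby1989, Ch. I §2] -/
theorem IsSurgery.reverseComponent_holds : IsSurgery.reverseComponent.{u, v, w, u'} :=
  fun h i ↦ h.reverseComponent' i

end FramedLink

end Literature.Topology.FourManifolds
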